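import Mathlib
import Literature.NumberTheory.LFunctions.FeketePolynomial
import Summits.ValiantsHypothesis.ValiantsHypothesis.Theorems.FeketeSOSFeketeNoSparseSplit

/-!
# Crux `FeketeSOS.SublinearShadow` (stmt-ValiantsHypothesis-14990), line `Sketch`
# (window / DFT de-bordering), stub `stub_threeSquares`: sublinear representations have `≥ 3` squares

A complex weighted sum-of-squares representation `Σ_{i<s} c_i g_i² = F_p` of the Fekete polynomial
`F_p = Σ_{m<p} (m|p) X^m` of SUBLINEAR cost (`S⁴ ≤ p³`, `S = Σ_i |supp g_i|`) has `s ≥ 3` once `p ≥ 257`,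
so the open core of the line may assume at least three squares.

Proof.  `s = 0`: the empty sum is `0 ≠ F_p` (`map_feketePolynomial_ne_zero`).  `s = 1, 2`: the
representation is a SPLITTING `A · B = F_p` with `|supp A| + |supp B| ≤ 2 S` — for one square
`A = g₀`, `B = c₀ g₀`; for two squares `A, B = a g₀ ± i b g₁` with `a² = c₀`, `b² = c₁` (as in the
landed `SplitOfTwoSquares`).  The landed linear bound `feketeNoSparseCyclicSplit` (crux
`FeketeNoSparseSplit`) gives `(p+3)/2 ≤ |supp A| + |supp B| ≤ 2 S`, so `p < 4 S` and
`p⁴ < (4S)⁴ = 256 S⁴ ≤ 256 p³ < 257 p³ ≤ p⁴` — impossible.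
-/

namespace Summit.ValiantsHypothesis.ValiantsHypothesis.Theorems.SublinearShadowSketch

open Polynomial Finset
open scoped BigOperators
open Literature.NumberTheory.LFunctions
open Summit.ValiantsHypothesis.ValiantsHypothesis.Theorems.FeketeNoSparseSplitCyclic

-- `Summit.ValiantsHypothesis.ValiantsHypothesis.…` is the tree's mandated single-conjunct layout (Sub = Summit).
set_option linter.dupNamespace false

/-- **A polynomial splitting of `F_p` is not sparse** (the landed `C⁺` of crux `FeketeNoSparseSplit`,
specialised from cyclic to genuine splittings): if `A · B = Σ_{m<p} (m|p) X^m` over `ℂ` and `p` is odd, then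
`(p+3)/2 ≤ |supp A| + |supp B|`. -/
theorem tsq_split_bound (p : ℕ) [Fact p.Prime] (hp2 : p ≠ 2) (A B : ℂ[X])
    (hAB : A * B = ∑ m ∈ Finset.range p, Polynomial.C ((legendreSym p m : ℤ) : ℂ) * Polynomial.X ^ m) :
    (p + 3) / 2 ≤ A.support.card + B.support.card := by
  have hAB' : A * B = (feketePolynomial p).map (Int.castRingHom ℂ) := by
    rw [map_feketePolynomial_complex]; exact hAB
  have hF0 : (feketePolynomial p).map (Int.castRingHom ℂ) ≠ 0 := map_feketePolynomial_ne_zero ℂ p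
  have hFdeg : ((feketePolynomial p).map (Int.castRingHom ℂ)).natDegree < p :=
    natDegree_map_feketePolynomial_lt ℂ p
  have hA : A.natDegree < p :=
    lt_of_le_of_lt (natDegree_le_of_dvd (Dvd.intro _ hAB') hF0) hFdeg
  have hB : B.natDegree < p :=
    lt_of_le_of_lt (natDegree_le_of_dvd (Dvd.intro_left _ hAB') hF0) hFdeg
  have hdiv : (X ^ p - 1 : ℂ[X]) ∣ A * B - (feketePolynomial p).map (Int.castRingHom ℂ) := by
    rw [hAB', sub_self]
    exact dvd_zero _
  exact feketeNoSparseCyclicSplit p hp2 A B hA hB hdiv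

/-- **The arithmetic of the stub**: `(p+3)/2 ≤ T ≤ 2 S` together with `S⁴ ≤ p³` is impossible for
`p ≥ 257` (`p < 4S`, so `p⁴ < 256 S⁴ ≤ 256 p³ < p⁴`). -/
theorem tsq_arith (p S T : ℕ) (hp : 257 ≤ p) (hT : (p + 3) / 2 ≤ T) (hTS : T ≤ 2 * S)
    (hS : S ^ 4 ≤ p ^ 3) : False := by
  have h4 : p < 4 * S := by omega
  have hp3 : 0 < p ^ 3 := by positivity
  have key : p ^ 4 < p ^ 4 :=
    calc p ^ 4 < (4 * S) ^ 4 := Nat.pow_lt_pow_left h4 (by norm_num)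
      _ = 256 * S ^ 4 := by ring
      _ ≤ 256 * p ^ 3 := Nat.mul_le_mul_left _ hS
      _ < 257 * p ^ 3 := Nat.mul_lt_mul_of_pos_right (by norm_num) hp3
      _ ≤ p * p ^ 3 := Nat.mul_le_mul_right _ hp
      _ = p ^ 4 := by ring
  exact lt_irrefl _ key

/-- **Scaling does not enlarge the support**: `|supp (C a · g)| ≤ |supp g|`. -/
theorem tsq_card_support_C_mul_le (a : ℂ) (g : ℂ[X]) : (C a * g).support.card ≤ g.support.card := by
  simpa only [Polynomial.smul_eq_C_mul] using Finset.card_le_card (Polynomial.support_smul a g)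

/-- **Support of a two-term combination**: `|supp (C a · g + C b · h)| ≤ |supp g| + |supp h|`. -/
theorem tsq_card_support_C_mul_add_C_mul_le (a b : ℂ) (g h : ℂ[X]) :
    (C a * g + C b * h).support.card ≤ g.support.card + h.support.card :=
  calc (C a * g + C b * h).support.card
      ≤ ((C a * g).support ∪ (C b * h).support).card := Finset.card_le_card Polynomial.support_add
    _ ≤ (C a * g).support.card + (C b * h).support.card := Finset.card_union_le _ _
    _ ≤ g.support.card + h.support.card :=
        Nat.add_le_add (tsq_card_support_C_mul_le a g) (tsq_card_support_C_mul_le b h)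

/-- **Two weighted squares split**: `C (a²) g₀² + C (b²) g₁² = (a g₀ + i b g₁) · (a g₀ − i b g₁)` in `ℂ[X]`. -/
theorem tsq_two_squares_split (a b : ℂ) (g₀ g₁ : ℂ[X]) :
    (C a * g₀ + C (Complex.I * b) * g₁) * (C a * g₀ + C (-(Complex.I * b)) * g₁)
      = C (a ^ 2) * g₀ ^ 2 + C (b ^ 2) * g₁ ^ 2 := by
  have hI : (Complex.I * b) ^ 2 = -(b ^ 2) := by
    rw [mul_pow, Complex.I_sq]; ring
  have key : (C a * g₀ + C (Complex.I * b) * g₁) * (C a * g₀ + C (-(Complex.I * b)) * g₁)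
      = C (a ^ 2) * g₀ ^ 2 - C ((Complex.I * b) ^ 2) * g₁ ^ 2 := by
    simp only [map_neg, map_pow, map_mul]
    ring
  rw [key, hI, map_neg]
  ring

/-- **Sublinear representations have at least three squares.**  For a prime `p ≥ 257`, every complex
representation `Σ_{i<s} c_i g_i² = Σ_{m<p} (m|p) X^m` with `(Σ_i |supp g_i|)⁴ ≤ p³` has `3 ≤ s`:
`s = 0` gives `0 = F_p`, and `s = 1, 2` give a splitting `A · B = F_p` of support-sum `≤ 2 S`, against the
landed linear bound `(p+3)/2 ≤ |supp A| + |supp B|` (`feketeNoSparseCyclicSplit`). -/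
theorem stub_threeSquares (p : ℕ) [Fact p.Prime] (hp : 257 ≤ p) (s : ℕ) (c : Fin s → ℂ) (g : Fin s → Polynomial ℂ)
    (hS : (∑ i, (g i).support.card) ^ 4 ≤ p ^ 3)
    (hrep : (∑ i, Polynomial.C (c i) * g i ^ 2)
      = ∑ m ∈ Finset.range p, Polynomial.C ((legendreSym p m : ℤ) : ℂ) * Polynomial.X ^ m) :
    3 ≤ s := by
  have hp2 : p ≠ 2 := by omega
  by_contra hlt
  obtain rfl | rfl | rfl : s = 0 ∨ s = 1 ∨ s = 2 := by omega
  · -- no squares: `0 = F_p`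
    rw [Fin.sum_univ_zero] at hrep
    have hF0 : (feketePolynomial p).map (Int.castRingHom ℂ) ≠ 0 := map_feketePolynomial_ne_zero ℂ p
    rw [map_feketePolynomial_complex] at hF0
    exact hF0 hrep.symm
  · -- one square: the splitting `g₀ · (c₀ g₀) = F_p`
    rw [Fin.sum_univ_one] at hrep hS
    have hsplit : g 0 * (C (c 0) * g 0)
        = ∑ m ∈ Finset.range p, Polynomial.C ((legendreSym p m : ℤ) : ℂ) * Polynomial.X ^ m := by
      rw [← hrep]; ring
    have hnat := tsq_split_bound p hp2 (g 0) (C (c 0) * g 0) hsplit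
    have hcard := tsq_card_support_C_mul_le (c 0) (g 0)
    exact tsq_arith p ((g 0).support.card) _ hp hnat (by omega) hS
  · -- two squares: the splitting `(a g₀ + i b g₁) · (a g₀ − i b g₁) = F_p`, `a² = c₀`, `b² = c₁`
    rw [Fin.sum_univ_two] at hrep hS
    obtain ⟨a, ha⟩ := IsAlgClosed.exists_pow_nat_eq (c 0) (n := 2) two_pos
    obtain ⟨b, hb⟩ := IsAlgClosed.exists_pow_nat_eq (c 1) (n := 2) two_pos
    have hsplit : (C a * g 0 + C (Complex.I * b) * g 1) * (C a * g 0 + C (-(Complex.I * b)) * g 1)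
        = ∑ m ∈ Finset.range p, Polynomial.C ((legendreSym p m : ℤ) : ℂ) * Polynomial.X ^ m := by
      rw [tsq_two_squares_split, ha, hb, hrep]
    have hnat := tsq_split_bound p hp2 _ _ hsplit
    have h0 := tsq_card_support_C_mul_add_C_mul_le a (Complex.I * b) (g 0) (g 1)
    have h1 := tsq_card_support_C_mul_add_C_mul_le a (-(Complex.I * b)) (g 0) (g 1)
    exact tsq_arith p ((g 0).support.card + (g 1).support.card) _ hp hnat (by omega) hS

end Summit.ValiantsHypothesis.ValiantsHypothesis.Theorems.SublinearShadowSketch
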